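import Literature.NumberTheory.EllipticCurves.LiXu2026.AnticyclotomicMordellWeilRankGrowth
import Mathlib.Analysis.Analytic.Order
import Mathlib.Order.LiminfLimsup
import Mathlib.Topology.Algebra.Order.LiminfLimsup
import HarnessLib

/-!
# Li–Xu 2026 (J. Number Theory, doi:10.1016/j.jnt.2026.06.001 = arXiv:2502.12648; REFEREED), §6,
# Theorem 6.1: the DENSITIES of even / odd central vanishing orders among the anticyclotomic twists
# `L(φρ, s)`, `ρ` a character of `Gal(K^{ac}_N/K)`, as `N → ∞` — split: `→ (1 ± W(φ))/2`; inert: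
# oscillating, `liminf = 1/(p+1)`, `limsup = p/(p+1)`; RAMIFIED: `→ 1/2` (the refereed form of
# "the root numbers equidistribute within every layer", BKNO (1.1)/Def. 1.1) — typed STATEMENTS for
# `A_φ = E/ℚ` (refereed named facts) + a proved corollary (divergence in the inert case)

Topic `NumberTheory/EllipticCurves`, sub-directory `LiXu2026` (namespace = path); second section file of
the paper (§6), companion of `AnticyclotomicMordellWeilRankGrowth.lean` (§1/§3.3.1/§5: Theorem 1,
Thm. 3.11 (i), Prop. 5.2). Cross-ladder literature-typing layer (cell `bsd-littype`, seat 10, gen 4).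
WHY: Burungale–Kobayashi–Nakamura–Ota (arXiv:2608.06879, preprint) build their signed theory at a
ramified `p` on "(1.1): the root numbers equidistribute within every layer of the anticyclotomic tower"
(typed as the preprint binder `BurungaleKobayashiNakamuraOta2026.eqn11_rootNumber_pow_OPEN`); the
REFEREED statement of that equidistribution — as a density `1/2` of even / odd central orders — is
Li–Xu's Theorem 6.1 (ramified case), vendored here by name together with the split and inert cases.

## The printed statement (arXiv:2502.12648 §6, LaTeX chunk p0018; §1.4, chunk p0004)

"To formalize this discussion, we define subsets of `𝔜_n` as follows:
`𝔜_n^± := {ρ ∈ 𝔜_n : ord_{s=1} L(φρ, s) ≡ (1 − ±1)/2 (mod 2)}`. The "frequency" of even and odd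
vanishing orders is represented by the sequences `{𝐏^±_N := #𝔜_N^± / #𝔜_N}_{N ≥ 0}`. Using Theorem 3.11
and Theorem 1.1 [Rohrlich–Jia], we establish the following results. **Theorem 6.1.** The behavior of
`𝐏_N^±` as `N → ∞` can be described as follows. • When `p` splits in `K`, `𝐏_N^+ → (W(φ)+1)/2`,
`𝐏_N^− → −(W(φ)−1)/2`. • When `p` remains inert in `K`, we show the limit of each `𝐏` [along `N` even /
odd] in the following table [table not reproduced in the held LaTeX extraction]. In particular,
`liminf_{N→∞} 𝐏_N^± = 1/(p+1)`, `limsup_{N→∞} 𝐏_N^± = p/(p+1)`, and both `{𝐏_N^+}` and `{𝐏_N^−}`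
diverge as `N → ∞`. • When `p` ramifies in `K`, `𝐏_N^+, 𝐏_N^− → 1/2`." (§1.4: "When `p` ramifies in
`K`, then 50% of the anticyclotomic twists `φρ` have even vanishing order at `s=1`, and 50% have odd
vanishing order at `s=1`. This phenomenon is independent of the root number `W(φ)`.") Here (§2.1.2,
chunk p0006) `𝔜_N` is the set of characters of `Gal(K^{ac}_∞/K)` factoring through `Gal(K^{ac}_N/K)`
(so `#𝔜_N = p^N`), `φ` is a unitary anticyclotomic Hecke character of `K` of infinite type `(1,0)` and
`A_φ` its CM abelian variety; for `A_φ = E/ℚ` with CM (§1.1, Rem. 4.3) `φ` is Deuring's character.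

## Transcription on the tree's objects (dictionary of the sibling files)

* The CM frame for `E/ℚ` (maximal order: `W.j ∈ maximalCMJInvariants`, `IsCMFieldOfJ K W.j`, complex
  conjugation `c ≠ 1`, `φ` by Deuring's clauses, `W(φ) = w ∈ ℤ` via `IsCentralRootNumber φ w`); `p` odd;
  split / inert / ramified as in the siblings (`p ∤ d_K ∧ p𝒪_K` not prime / `p𝒪_K` prime / `p ∣ d_K`);
  `κ` an anticyclotomic `ℤ_p`-extension of `K`; `ι : ℚ̄_p ≅ ℂ` fixed (avatars).
* `𝔜_N` ↦ `acCharacters ι κ N := {ρ | ∃ r, IsAcCharacter ι κ N ρ r}` (finite-order Hecke characters of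
  `K` whose `p`-adic avatar factors through `Gal(K^{ac}_N/K)`; sibling vocabulary).
* "`ord_{s=1} L(φρ, s)` even / odd" ↦ `HasEvenCentralOrder (φ * ρ)` / `HasOddCentralOrder (φ * ρ)`: there is
  an entire continuation `F` of `L(s, φρ)` from `re s > 3/2` (`IsEntireContinuationWt2`, the predicate
  of `RohrlichAnticyclotomicNonvanishing.lean`; unique when it exists) whose order of vanishing at
  `s = 1` (Mathlib `analyticOrderNatAt F 1`) is even / odd. (The continuation exists by Hecke; the tree
  does not prove it — in its absence neither predicate holds, and the densities below are those of
  print exactly when the printed objects exist, which is the intended reading of a named fact.)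
* `𝐏^±_N` ↦ `evenDensity ι κ φ N`, `oddDensity ι κ φ N : ℝ` = `#{ρ ∈ 𝔜_N : even/odd} / #𝔜_N` with
  `Set.ncard` (literal; `#𝔜_N = p^N` in print).
* Limits: `Filter.Tendsto … atTop (𝓝 ℓ)`; `Filter.liminf / limsup … atTop`.

## What is here

* Definitions (bodies): `HasEvenCentralOrder`, `HasOddCentralOrder`, `acCharacters`, `evenDensity`,
  `oddDensity` (+ unfolding lemmas).
* `thm61_density_split`, `thm61_density_inert`, `thm61_density_ramified` — Theorem 6.1 for `A_φ = E`
  (refereed named facts).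
* PROVED: `not_tendsto_density_of_inert` ("both `{𝐏_N^+}` and `{𝐏_N^−}` diverge": a real sequence
  with `liminf ≠ limsup` has no limit — `Filter.Tendsto.liminf_eq/limsup_eq`; `1/(p+1) ≠ p/(p+1)` for
  `p > 1`).

## What is NOT here

The inert table of limits along `N` even / `N` odd separately (the table body is not recoverable from
the held LaTeX extraction; only the "In particular" sentence is typed — to be completed from the
journal text); Theorem 6.1 for a general `A_φ` (no CM abelian varieties in the tree); the identity
`𝐏_N^+ + 𝐏_N^− = 1` (needs the existence of the continuations — Hecke — not a tree theorem).

References: [LiXu2026] §6 Thm. 6.1 and (6.1) (chunk p0018), §1.4 (p0004), §2.1.2 (p0006)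
[corpus: paper:arxiv-2502.12648 p0018, p0004, p0006]; [BurungaleKobayashiNakamuraOta2026] (1.1) and
Def. 1.1 (arXiv:2608.06879 pp. 3–4; tree `eqn11_rootNumber_pow_OPEN`, `exists_rootNumber_neg_of_eqn11_OPEN`);
[Rohrlich1984Anticyclotomic] (tree `RohrlichJia_centralOrder_anticyclotomicTwists`).
-/

noncomputable section

open scoped Classical Topology
open Filter WeierstrassCurve NumberField IsDedekindDomain
open Literature.NumberTheory.Automorphic Literature.NumberTheory.GaloisRepresentations
open Literature.NumberTheory.EllipticCurves.BurungaleKobayashiNakamuraOta2026 (IsAcCharacter)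

namespace Literature.NumberTheory.EllipticCurves.LiXu2026

/-! ## §0 The printed objects `𝔜_N`, `𝔜_N^±`, `𝐏_N^±` -/

section Objects

variable {K : Type} [Field K] [NumberField K] {p : ℕ} [Fact p.Prime]

/-- **`ord_{s=1} L(χ, s)` is EVEN**: some (hence the) entire continuation `F` of `L(s, χ)` from
`re s > 3/2` (`IsEntireContinuationWt2 χ F`) vanishes to even order at `s = 1` (Mathlib
`analyticOrderNatAt`). Li–Xu (6.1): "`ord_{s=1} L(φρ, s) ≡ 0 (mod 2)`".
[cite: LiXu2026, §6 (6.1) (arXiv:2502.12648)] -/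
def HasEvenCentralOrder (χ : HeckeCharacter K) : Prop :=
  ∃ F : ℂ → ℂ, IsEntireContinuationWt2 χ F ∧ Even (analyticOrderNatAt F 1)

/-- **`ord_{s=1} L(χ, s)` is ODD** (same reading). Li–Xu (6.1): "`ord_{s=1} L(φρ, s) ≡ 1 (mod 2)`".
[cite: LiXu2026, §6 (6.1) (arXiv:2502.12648)] -/
def HasOddCentralOrder (χ : HeckeCharacter K) : Prop :=
  ∃ F : ℂ → ℂ, IsEntireContinuationWt2 χ F ∧ Odd (analyticOrderNatAt F 1)

/-- **`𝔜_N`**: the finite-order Hecke characters `ρ` of `K` that are characters of `Gal(K^{ac}_N/K)` —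
some `p`-adic avatar `r` of `ρ` factors through `Γ^{ac}` and is trivial on `Gal(K̄/K^{ac}_N)`
(`IsAcCharacter ι κ N ρ r`). Li–Xu §2.1.2: "`𝔜_n` … the subset of `𝔜` consisting of Galois characters
… factoring through [`Gal(K^{ac}_n/K)`]". [cite: LiXu2026, §2.1.2 (arXiv:2502.12648)] -/
def acCharacters (ι : PadicAlgCl p ≃+* ℂ) (κ : ZpExtension K p) (N : ℕ) : Set (HeckeCharacter K) :=
  {ρ | ∃ r : FramedGaloisRep K (PadicAlgCl p) 1, IsAcCharacter ι κ N ρ r}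

/-- **`𝐏^+_N = #𝔜_N^+ / #𝔜_N`**, the proportion of `ρ ∈ 𝔜_N` with `ord_{s=1} L(φρ, s)` even (`Set.ncard`,
real quotient). [cite: LiXu2026, §6 (the sequences 𝐏^±_N) (arXiv:2502.12648)] -/
def evenDensity (ι : PadicAlgCl p ≃+* ℂ) (κ : ZpExtension K p) (φ : HeckeCharacter K) (N : ℕ) : ℝ :=
  (({ρ ∈ acCharacters ι κ N | HasEvenCentralOrder (φ * ρ)} : Set (HeckeCharacter K)).ncard : ℝ) /
    ((acCharacters ι κ N).ncard : ℝ)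

/-- **`𝐏^−_N = #𝔜_N^− / #𝔜_N`**, the proportion of `ρ ∈ 𝔜_N` with `ord_{s=1} L(φρ, s)` odd.
[cite: LiXu2026, §6 (the sequences 𝐏^±_N) (arXiv:2502.12648)] -/
def oddDensity (ι : PadicAlgCl p ≃+* ℂ) (κ : ZpExtension K p) (φ : HeckeCharacter K) (N : ℕ) : ℝ :=
  (({ρ ∈ acCharacters ι κ N | HasOddCentralOrder (φ * ρ)} : Set (HeckeCharacter K)).ncard : ℝ) /
    ((acCharacters ι κ N).ncard : ℝ)

/-- Unfolding of `acCharacters`. [cite: LiXu2026, §2.1.2 (arXiv:2502.12648)] -/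
theorem mem_acCharacters_iff (ι : PadicAlgCl p ≃+* ℂ) (κ : ZpExtension K p) (N : ℕ)
    (ρ : HeckeCharacter K) :
    ρ ∈ acCharacters ι κ N ↔ ∃ r : FramedGaloisRep K (PadicAlgCl p) 1, IsAcCharacter ι κ N ρ r :=
  Iff.rfl

/-- `𝔜_N ⊆ 𝔜_{N+1}` (a character of `Gal(K^{ac}_N/K)` is one of `Gal(K^{ac}_{N+1}/K)`:
`κ.layerSubgroup (N+1) ≤ κ.layerSubgroup N`). [cite: LiXu2026, §2.1.2 (arXiv:2502.12648)] -/
theorem acCharacters_mono (ι : PadicAlgCl p ≃+* ℂ) (κ : ZpExtension K p) :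
    Monotone (acCharacters ι κ) := by
  refine monotone_nat_of_le_succ fun N ρ hρ ↦ ?_
  obtain ⟨r, hr⟩ := hρ
  refine ⟨r, ⟨hr.hasInfinityType, hr.isAvatar, hr.factorsThrough, fun σ hσ ↦ hr.level σ ?_⟩⟩
  exact κ.layerSubgroup_antitone (Nat.le_succ N) hσ

/-- The two densities are nonnegative. [cite: LiXu2026, §6 (arXiv:2502.12648)] -/
theorem evenDensity_nonneg (ι : PadicAlgCl p ≃+* ℂ) (κ : ZpExtension K p) (φ : HeckeCharacter K)
    (N : ℕ) : 0 ≤ evenDensity ι κ φ N := by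
  unfold evenDensity; positivity

/-- The two densities are nonnegative. [cite: LiXu2026, §6 (arXiv:2502.12648)] -/
theorem oddDensity_nonneg (ι : PadicAlgCl p ≃+* ℂ) (κ : ZpExtension K p) (φ : HeckeCharacter K)
    (N : ℕ) : 0 ≤ oddDensity ι κ φ N := by
  unfold oddDensity; positivity

end Objects

/-! ## §1 Theorem 6.1 for `A_φ = E/ℚ` (refereed named facts; nothing proved here) -/

/-- **Li–Xu 2026, Theorem 6.1, SPLIT case, for `A_φ = E`** — "When `p` splits in `K`,
`𝐏_N^+ → (W(φ)+1)/2`, `𝐏_N^− → −(W(φ)−1)/2`" (all twists have the root number `W(φ)`, Thm. 3.11 (i),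
so for `N ≫ 0` the central orders are all even or all odd up to a bounded set). Transcription (module
docstring): maximal-order CM frame, `φ` by Deuring's clauses, `W(φ) = w ∈ ℤ`; `p` odd split
(`p ∤ d_K`, `p𝒪_K` not prime); `κ` anticyclotomic, `ι : ℚ̄_p ≅ ℂ`; conclusion
`evenDensity → (w+1)/2` and `oddDensity → (1−w)/2`. REFEREED. No `_holds`.
[cite: LiXu2026, Thm. 6.1 (split case) (arXiv:2502.12648 §6)] -/
def thm61_density_split : Prop :=
  ∀ (W : WeierstrassCurve ℚ) [W.IsElliptic], W.j ∈ maximalCMJInvariants →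
    ∀ (K : Type) [Field K] [NumberField K], IsCMFieldOfJ K W.j → ∀ (c : K ≃ₐ[ℚ] K), c ≠ 1 →
      ∀ (φ : HeckeCharacter K), φ.HasInfinityType (fun _ ↦ 1) (fun _ ↦ 0) →
        IsHeckeConjEquivariant c φ → (∀ s : ℂ, 3 / 2 < s.re → heckeLFunction φ s = W.LSeries s) →
      ∀ (w : ℤ), IsCentralRootNumber φ w →
      ∀ (p : ℕ) [Fact p.Prime], p ≠ 2 → ¬ (p : ℤ) ∣ cmFieldDiscr W.j →
        ¬ (Ideal.span {(p : 𝓞 K)}).IsPrime →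
        ∀ (κ : ZpExtension K p), κ.IsAnticyclotomic → ∀ (ι : PadicAlgCl p ≃+* ℂ),
          Tendsto (evenDensity ι κ φ) atTop (𝓝 (((w : ℝ) + 1) / 2)) ∧
            Tendsto (oddDensity ι κ φ) atTop (𝓝 ((1 - (w : ℝ)) / 2))

/-- **Li–Xu 2026, Theorem 6.1, INERT case, for `A_φ = E`: the densities OSCILLATE** — "When `p`
remains inert in `K` […] In particular, `liminf_{N→∞} 𝐏_N^± = 1/(p+1)`, `limsup_{N→∞} 𝐏_N^± = p/(p+1)`,
and both `{𝐏_N^+}` and `{𝐏_N^−}` diverge as `N → ∞`." (§1.4: "the probabilities … fluctuate in the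
interval `[1/(p+1), p/(p+1)]`. This fluctuation is characterized by the parity of the level of `ρ`, as
well as the root number `W(φ)`, the conductor of `φ_p`, and the class group of `K`.") Transcription:
the frame of `thm61_density_split` with `p𝒪_K` prime (inert); NO reduction hypothesis (as printed: the
liminf / limsup values do not depend on `f(φ_p)`); conclusion: `liminf` and `limsup` of both densities
along `atTop` are `1/(p+1)` and `p/(p+1)`. (The finer table of limits along `N` even / odd is not
typed — module docstring.) The divergence clause is PROVED below from this (`not_tendsto_density_of_inert`).
REFEREED. No `_holds`. [cite: LiXu2026, Thm. 6.1 (inert case) and §1.4 (arXiv:2502.12648 §6)] -/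
def thm61_density_inert : Prop :=
  ∀ (W : WeierstrassCurve ℚ) [W.IsElliptic], W.j ∈ maximalCMJInvariants →
    ∀ (K : Type) [Field K] [NumberField K], IsCMFieldOfJ K W.j → ∀ (c : K ≃ₐ[ℚ] K), c ≠ 1 →
      ∀ (φ : HeckeCharacter K), φ.HasInfinityType (fun _ ↦ 1) (fun _ ↦ 0) →
        IsHeckeConjEquivariant c φ → (∀ s : ℂ, 3 / 2 < s.re → heckeLFunction φ s = W.LSeries s) →
      ∀ (p : ℕ) [Fact p.Prime], p ≠ 2 → (Ideal.span {(p : 𝓞 K)}).IsPrime →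
        ∀ (κ : ZpExtension K p), κ.IsAnticyclotomic → ∀ (ι : PadicAlgCl p ≃+* ℂ),
          liminf (evenDensity ι κ φ) atTop = 1 / ((p : ℝ) + 1) ∧
            limsup (evenDensity ι κ φ) atTop = (p : ℝ) / ((p : ℝ) + 1) ∧
          liminf (oddDensity ι κ φ) atTop = 1 / ((p : ℝ) + 1) ∧
            limsup (oddDensity ι κ φ) atTop = (p : ℝ) / ((p : ℝ) + 1)

/-- **Li–Xu 2026, Theorem 6.1, RAMIFIED case, for `A_φ = E`: the densities of even and odd central
orders both tend to `1/2`** — "When `p` ramifies in `K`, `𝐏_N^+, 𝐏_N^− → 1/2`." (§1.4: "50% of the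
anticyclotomic twists `φρ` have even vanishing order at `s=1`, and 50% have odd vanishing order at
`s=1`. This phenomenon is independent of the root number `W(φ)`"; proof: "half of the invertible
residue classes modulo `p` are quadratic residues, and the other half are non-residues" with
Thm. 3.11 (iv)(v) — the REFEREED form of BKNO's "(1.1): the root numbers equidistribute within every
layer", `BurungaleKobayashiNakamuraOta2026.eqn11_rootNumber_pow_OPEN`.) Transcription: the frame of
`thm61_density_split` with `p ∣ d_K` (ramified), no reduction hypothesis; conclusion: both densities
`→ 1/2`. REFEREED. No `_holds`. [cite: LiXu2026, Thm. 6.1 (ramified case) and §1.4 (arXiv:2502.12648 §6)]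
[claim: BurungaleKobayashiNakamuraOta2026, status: under-review] -/
def thm61_density_ramified : Prop :=
  ∀ (W : WeierstrassCurve ℚ) [W.IsElliptic], W.j ∈ maximalCMJInvariants →
    ∀ (K : Type) [Field K] [NumberField K], IsCMFieldOfJ K W.j → ∀ (c : K ≃ₐ[ℚ] K), c ≠ 1 →
      ∀ (φ : HeckeCharacter K), φ.HasInfinityType (fun _ ↦ 1) (fun _ ↦ 0) →
        IsHeckeConjEquivariant c φ → (∀ s : ℂ, 3 / 2 < s.re → heckeLFunction φ s = W.LSeries s) →
      ∀ (p : ℕ) [Fact p.Prime], p ≠ 2 → (p : ℤ) ∣ cmFieldDiscr W.j →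
        ∀ (κ : ZpExtension K p), κ.IsAnticyclotomic → ∀ (ι : PadicAlgCl p ≃+* ℂ),
          Tendsto (evenDensity ι κ φ) atTop (𝓝 (1 / 2)) ∧ Tendsto (oddDensity ι κ φ) atTop (𝓝 (1 / 2))

/-! ## §2 Proved corollary (kernel; the fact enters as a hypothesis) -/

/-- Plumbing: a real sequence whose `liminf` and `limsup` along `atTop` differ has no limit
(`Filter.Tendsto.liminf_eq`, `Filter.Tendsto.limsup_eq`). [folklore] -/
private theorem not_tendsto_of_liminf_ne_limsup {u : ℕ → ℝ}
    (h : liminf u atTop ≠ limsup u atTop) : ¬ ∃ ℓ : ℝ, Tendsto u atTop (𝓝 ℓ) := by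
  rintro ⟨ℓ, hℓ⟩
  exact h (by rw [hℓ.liminf_eq, hℓ.limsup_eq])

/-- **"both `{𝐏_N^+}` and `{𝐏_N^−}` diverge as `N → ∞`"** (Thm. 6.1, inert case, last clause): granted
the inert `liminf / limsup` values (hypothesis `h61`), neither density has a limit, since
`1/(p+1) ≠ p/(p+1)` for a prime `p`. PROVED. [cite: LiXu2026, Thm. 6.1 (inert case) (arXiv:2502.12648 §6)] -/
theorem not_tendsto_density_of_inert (h61 : thm61_density_inert)
    (W : WeierstrassCurve ℚ) [W.IsElliptic] (hj : W.j ∈ maximalCMJInvariants)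
    (K : Type) [Field K] [NumberField K] (hK : IsCMFieldOfJ K W.j) (c : K ≃ₐ[ℚ] K) (hc : c ≠ 1)
    (φ : HeckeCharacter K) (hφ : φ.HasInfinityType (fun _ ↦ 1) (fun _ ↦ 0))
    (heq : IsHeckeConjEquivariant c φ) (hL : ∀ s : ℂ, 3 / 2 < s.re → heckeLFunction φ s = W.LSeries s)
    (p : ℕ) [Fact p.Prime] (hp : p ≠ 2) (hinert : (Ideal.span {(p : 𝓞 K)}).IsPrime)
    (κ : ZpExtension K p) (hκ : κ.IsAnticyclotomic) (ι : PadicAlgCl p ≃+* ℂ) :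
    (¬ ∃ ℓ : ℝ, Tendsto (evenDensity ι κ φ) atTop (𝓝 ℓ)) ∧
      ¬ ∃ ℓ : ℝ, Tendsto (oddDensity ι κ φ) atTop (𝓝 ℓ) := by
  obtain ⟨h1, h2, h3, h4⟩ := h61 W hj K hK c hc φ hφ heq hL p hp hinert κ hκ ι
  have hp1 : (1 : ℝ) < p := by exact_mod_cast (Fact.out : p.Prime).one_lt
  have hne : (1 : ℝ) / ((p : ℝ) + 1) ≠ (p : ℝ) / ((p : ℝ) + 1) := by
    intro h
    have hpos : (0 : ℝ) < (p : ℝ) + 1 := by linarith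
    rw [div_eq_div_iff hpos.ne' hpos.ne'] at h
    nlinarith
  refine ⟨not_tendsto_of_liminf_ne_limsup ?_, not_tendsto_of_liminf_ne_limsup ?_⟩
  · rw [h1, h2]; exact hne
  · rw [h3, h4]; exact hne

end Literature.NumberTheory.EllipticCurves.LiXu2026
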